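import Literature.MathematicalPhysics.QuantumFieldTheory.Balaban1983to89.B9LettersZCFieldsAtPins
import Literature.MathematicalPhysics.QuantumFieldTheory.Balaban1983to89.B9LettersHZAtOne
import Literature.MathematicalPhysics.QuantumFieldTheory.Balaban1983to89.B9LettersZSchemasMono

/-!
# BalabanUVNodes ∕ N06 ([B9], `Dag.B9_main`) — ROWS 20–21's COARSE-CLASS LETTER RECORD `LettersHZ` (the certificate's displayed binder `hlettersH12`) AT node00-def-Y's
# MEMBERS OF RECORD, DERIVED FROM THE G₀ LAYER'S (3.42)₀∕(3.42)₁ LETTERS AND ROW 26's (3.132) AS THE CERTIFICATE HOLDS IT — ∀-RATE-GUARDED BELOW ROW 26's PRODUCED RATE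

Track A of `YM-PLAN.md` (cell `pub-ymgap`, HUMAN RULING D-0062 ∕ D-0154), node **N06** = [Balaban1985BackgroundPropagators] Thms 3.1–3.15; width seat `pub-ymgap-dag-n06-w5`
(g6), 2026-08-28.  A HELPER for dag-n06-d's stage-11 certificate (editions ≥ 39 display `hlettersH12 : … LettersHZ (𝔬12 x) 1 (H x) _ (weightNorm (ofBlocks (𝔬12 x).blkZ) n⁻¹ _)
B12₃ δ12₃ U`, `Summits/…/Theorems/BalabanUVNodesN06AtOpsYNuOfRecordV6EPairNT.lean` :168).
WHY.  All four fields of `B9Thm312WholeHZ.LettersHZ` are theorems of material the certificate already holds: `gQs2` (`G₀Q*`) and `dgQs` (`∇_UG₀Q*`) from the G₀ layer's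
(3.42)₀ ∕ (3.42)₁ letters (`Thm33G0.e0`, `LeftStep.e1` — the certificate's DERIVED `hmodel12 ∕ hleft12`) by dag-n06-w5's `B9LettersZQstarFieldsAtPins.gQs2_pins ∕ dgQs_pins`
(p634692; the `Q*` letter + dag-n06-l's `gQs2_of_e0 ∕ dgQs_of_e1` + [4] (2.61)); `c2` (`C = (QGQ*)⁻¹`) and `c12` (`C₁ = (QG₁Q*)⁻¹`) from row 26's `B9.Stmt3132Printed` at the instance of
record — the certificate's own `s3132` (built from `hmodel12` + row 17, NOT from Theorem 3.12, so feeding it here is not circular) — by dag-n06-w5's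
`B9LettersZCFieldsAtPins.c2_c12_pins_of_row26` (p638945; dag-n06-i's ν-reading bridge p638273).  THE ONE DESIGN POINT: row 26's rate `δC` and constant are PRODUCED
(existential, hypothesis-dependent through `s3132`), so they are NOT closed terms a `NumericsWitness` could dominate; hence the conclusion is ∀-RATE-GUARDED: ONE produced
ceiling `δC > 0`, ONE produced constant `BH ≥ 0`, ONE threshold, ONE regime bound, and `LettersHZ … BH δ₃ U` for EVERY `0 ≤ δ₃ ≤ min δC δ12₀` — the consuming edition
`obtain`s first and runs rows 20–21 at `δ⋆ := min δ12₃ δC` (the other `(B12₃, δ12₃)`-binders weaken by `B9LettersZSchemasMono`, rate down ∕ constant up).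
WHAT.  ★★★ `hlettersH12_of_row26_pins` (statement below; inputs FIELD-LEVEL: `he0 ∕ he1` = `(hmodel12 …).1.e0 ∕ (hleft12 …).e1` as member-∀ binders at their own threshold
`M₀` and regime `a₀`; pins `hβ1 hblk12 hblkZ12 hQsco12 hCco12 hC1co12`; `h26` = the certificate's `s3132`).  Internals: [4] (2.61) at rate 1 above one threshold
(`rowSum261_geo9Y`, constant floored at 0), the `Q*`-rate `δ_Q := δC + 1`, `BH := max BC (B12₀·e^{(δC+1)(ℓ+4)}·max c₁ 0)`, threshold `max M₀ (max M_L M₄)`, regime `min a₀ a₄`.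
HONEST FRAMING.  By-name composition of kernel-checked helper files; the G₀-layer letters and row 26's conclusion are HYPOTHESES of the theorem (the node's content);
COUNT-NEUTRAL; nothing of [B9]'s propagator estimates asserted; N06 NOT discharged; K1 NOT closed; one finite 𝕋⁴ programme at fixed `ε` — NOT continuum, NOT OS, NOT the
mass gap ∕ Clay.  0 `def`, 0 `sorry`.
-/

noncomputable section

namespace Summit.QuantumFields.YangMills.BalabanUVNodes.N06LettersH12AtPinsPhys

open Literature.MathematicalPhysics.QuantumFieldTheory.Balaban1983to89
open Literature.MathematicalPhysics.QuantumFieldTheory.Balaban1983to89.Node00 (FBondY IBondY parBY parSymY GpPhysY Stage3Params ResY SectEY RWEY ExpsY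
  opsYNuOfRecordV4PE)
open Literature.MathematicalPhysics.QuantumFieldTheory.Balaban1983to89.Node00.OpsYSectDCoords (QscoKH CcoK C1coK)
open Literature.MathematicalPhysics.QuantumFieldTheory.Balaban1983to89.B6RandomWalk (HasMajorant)
open Literature.MathematicalPhysics.QuantumFieldTheory.Balaban1983to89.B6RandomWalkHom (HasMajorantHom)
open Literature.MathematicalPhysics.QuantumFieldTheory.Balaban1983to89.B7Prop2SpecialUnitary (specialUnitaryUnits)
open Literature.MathematicalPhysics.QuantumFieldTheory.Balaban1983to89.B9PinMembersKLevelV1 (MemberY geo9Y bg9Y)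
open Literature.MathematicalPhysics.QuantumFieldTheory.Balaban1983to89.B6GlobalChartV1 (blkV1)
open Literature.MathematicalPhysics.QuantumFieldTheory.Balaban1983to89.B6Ineq2142KLevelV1 (β lvl)
open Literature.MathematicalPhysics.QuantumFieldTheory.Balaban1983to89.B6Geom246MultiLevelTorus (geomT)
open Literature.MathematicalPhysics.QuantumFieldTheory.Balaban1983to89.B9CoReadingCoordsTranspose (TrIdx trBasis)
open Literature.MathematicalPhysics.QuantumFieldTheory.Balaban1983to89.B9CoReadingCoords (XBK blkBK)
open Literature.MathematicalPhysics.QuantumFieldTheory.Balaban1983to89.B9CoReadingCoordsH (XHK blkHK)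
open Literature.MathematicalPhysics.QuantumFieldTheory.Balaban1983to89.B9GeoNormsKLevelV1 (geo9K_dist_nonneg)
open Literature.MathematicalPhysics.QuantumFieldTheory.Balaban1983to89.B9GeoLemma21KLevelV1 (geo9Y_dist_triangle geo9Y_dist_comm geo9Y_len_pos rowSum261_geo9Y)
open Literature.MathematicalPhysics.QuantumFieldTheory.Balaban1983to89.B9Thm34Ext (toB6)
open Literature.MathematicalPhysics.QuantumFieldTheory.Balaban1983to89.B9SectDSup (weightNorm)
open Literature.MathematicalPhysics.QuantumFieldTheory.Balaban1983to89.B11SectG (HasMaj BlockNorm RowSum)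
open Literature.MathematicalPhysics.QuantumFieldTheory.Balaban1983to89.B9Thm312Whole (Ops GeoOK cNorm)
open Literature.MathematicalPhysics.QuantumFieldTheory.Balaban1983to89.B9Thm312WholeHZ (LettersHZ)
open Literature.MathematicalPhysics.QuantumFieldTheory.Balaban1983to89.B9LettersHZAtOne (plateau_pos)
open Literature.MathematicalPhysics.QuantumFieldTheory.Balaban1983to89.B9LettersZQstarFieldsAtPins (gQs2_pins dgQs_pins)
open Literature.MathematicalPhysics.QuantumFieldTheory.Balaban1983to89.B9LettersZCFieldsAtPins (c2_c12_pins_of_row26)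
open Literature.MathematicalPhysics.QuantumFieldTheory.Balaban1983to89.B9LettersZSchemasMono (kernel_mono)
open scoped Matrix.Norms.L2Operator

variable {N : ℕ} [NeZero N] {θ : Stage3Params} {Mstar : ℕ}
variable [∀ x : MemberY θ.d₆ θ.ℓ₆ θ.hd' θ.hL' θ.b₀ θ.b₁ Mstar, Fintype (geo9Y x).Site]

/-- ★★★ **THE WHOLE `LettersHZ` RECORD (`hlettersH12`) AT THE MEMBERS OF RECORD, ∀-RATE-GUARDED BELOW ROW 26's PRODUCED RATE** (module docstring): from the G₀ layer's
(3.42)₀ letter `he0` (`Thm33G0.e0`) and (3.42)₁ letter `he1` (`LeftStep.e1`) above their threshold `M₀` in their regime `a₀`, the pins `hβ1 hblk12 hblkZ12 hQsco12 hCco12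
hC1co12`, and row 26's conclusion `h26 : B9.Stmt3132Printed …` at the instance of record (all HYPOTHESES — the node's content), there are `MH, δC > 0, aH, BH ≥ 0` such
that for EVERY rate `0 ≤ δ₃ ≤ δC`, `δ₃ ≤ δ12₀`, every member above `MH`, every `0 < α₀` with `M·α₀ ≤ aH`, every `U` of the (3.35)∕(3.36) class:
`LettersHZ (𝔬12 x) 1 (H x) _ (weightNorm (ofBlocks (𝔬12 x).blkZ) n⁻¹ _) BH δ₃ U` — fields `gQs2 ∕ dgQs` by `gQs2_pins ∕ dgQs_pins` at `δ_Q := δC + 1` with [4] (2.61) at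
rate 1, fields `c2 ∕ c12` by `c2_c12_pins_of_row26` weakened from `(BC, δC)` to `(BH, δ₃)` (`kernel_mono`).
[cite: Balaban1985BackgroundPropagators, (3.126) p.420 + (3.132) p.422 + (3.153) p.426 + (3.42) p.397 + (3.110) p.417 + p.398 (remark after (3.47)); Balaban1984PropagatorsII, (2.51)–(2.56) pp.232–233 + Lemma 2.1 (2.60)–(2.61) p.234] -/
theorem hlettersH12_of_row26_pins (𝔯 : ResY N θ Mstar) (𝔢 : SectEY N θ Mstar) (𝔴 : RWEY N θ Mstar) (𝔈 : ExpsY N θ Mstar)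
    {Y W : MemberY θ.d₆ θ.ℓ₆ θ.hd' θ.hL' θ.b₀ θ.b₁ Mstar → Type} [∀ x, Fintype (Y x)] [∀ x, Fintype (W x)]
    (H : MemberY θ.d₆ θ.ℓ₆ θ.hd' θ.hL' θ.b₀ θ.b₁ Mstar → Prop)
    (bI : ∀ x : MemberY θ.d₆ θ.ℓ₆ θ.hd' θ.hL' θ.b₀ θ.b₁ Mstar, FBondY x.toKIdx → IBondY x.toKIdx)
    (hβ1 : ∀ (x : MemberY θ.d₆ θ.ℓ₆ θ.hd' θ.hL' θ.b₀ θ.b₁ Mstar) (f : FBondY x.toKIdx), (geomT x.D).dist (β x.hN x.D x.hk (bI x f)) (blkV1 x.hN x.D f) ≤ 1)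
    (𝔬12 : ∀ x : MemberY θ.d₆ θ.ℓ₆ θ.hd' θ.hL' θ.b₀ θ.b₁ Mstar, Ops (geo9Y x) (bg9Y (Matrix (Fin N) (Fin N) ℂ) (specialUnitaryUnits (Fin N)) x)
      (XBK (TrIdx N) x.toKIdx) (Y x) (XHK (TrIdx N) x.toKIdx) (W x))
    (hblk12 : ∀ x : MemberY θ.d₆ θ.ℓ₆ θ.hd' θ.hL' θ.b₀ θ.b₁ Mstar, (𝔬12 x).blk = blkBK x.toKIdx (bI x))
    (hblkZ12 : ∀ x : MemberY θ.d₆ θ.ℓ₆ θ.hd' θ.hL' θ.b₀ θ.b₁ Mstar, (𝔬12 x).blkZ = blkHK x.toKIdx)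
    (hQsco12 : ∀ (x : MemberY θ.d₆ θ.ℓ₆ θ.hd' θ.hL' θ.b₀ θ.b₁ Mstar) (U : (bg9Y (Matrix (Fin N) (Fin N) ℂ) (specialUnitaryUnits (Fin N)) x).Cfg),
      (𝔬12 x).Qstar U = QscoKH x.toKIdx (trBasis N) (bg9Y (Matrix (Fin N) (Fin N) ℂ) (specialUnitaryUnits (Fin N)) x) (fun U => U) (parBY x.toKIdx) U)
    (hCco12 : ∀ (x : MemberY θ.d₆ θ.ℓ₆ θ.hd' θ.hL' θ.b₀ θ.b₁ Mstar) (U : (bg9Y (Matrix (Fin N) (Fin N) ℂ) (specialUnitaryUnits (Fin N)) x).Cfg),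
      (𝔬12 x).C U = CcoK x.toKIdx (trBasis N) (bg9Y (Matrix (Fin N) (Fin N) ℂ) (specialUnitaryUnits (Fin N)) x) (fun U => U)
        (parSymY x.toKIdx) (parBY x.toKIdx) (GpPhysY x.toKIdx (parSymY x.toKIdx)) U)
    (hC1co12 : ∀ (x : MemberY θ.d₆ θ.ℓ₆ θ.hd' θ.hL' θ.b₀ θ.b₁ Mstar) (U : (bg9Y (Matrix (Fin N) (Fin N) ℂ) (specialUnitaryUnits (Fin N)) x).Cfg),
      (𝔬12 x).C1 U = C1coK x.toKIdx (trBasis N) (bg9Y (Matrix (Fin N) (Fin N) ℂ) (specialUnitaryUnits (Fin N)) x) (fun U => U)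
        (parSymY x.toKIdx) (parBY x.toKIdx) (GpPhysY x.toKIdx (parSymY x.toKIdx)) (𝔯 x).Δ2 U)
    {B12₀ δ12₀ M₀ a₀ c35 : ℝ} (hB12₀ : 0 ≤ B12₀)
    (he0 : ∀ x : MemberY θ.d₆ θ.ℓ₆ θ.hd' θ.hL' θ.b₀ θ.b₁ Mstar, M₀ ≤ (geo9Y x).M → ∀ α₀ : ℝ, 0 < α₀ → (geo9Y x).M * α₀ ≤ a₀ →
      ∀ U : (bg9Y (Matrix (Fin N) (Fin N) ℂ) (specialUnitaryUnits (Fin N)) x).Cfg,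
        (bg9Y (Matrix (Fin N) (Fin N) ℂ) (specialUnitaryUnits (Fin N)) x).Reg335 c35 α₀ U →
        (bg9Y (Matrix (Fin N) (Fin N) ℂ) (specialUnitaryUnits (Fin N)) x).Reg336 c35 α₀ U →
          HasMajorant (g := toB6 (geo9Y x) 1 (H x)) (𝔬12 x).blk ((𝔬12 x).G0 U)
            (fun (a b : (geo9Y x).Site) => B12₀ * (geo9Y x).len a ^ 2 * Real.exp (-(δ12₀ * (geo9Y x).dist a b))))
    (he1 : ∀ x : MemberY θ.d₆ θ.ℓ₆ θ.hd' θ.hL' θ.b₀ θ.b₁ Mstar, M₀ ≤ (geo9Y x).M → ∀ α₀ : ℝ, 0 < α₀ → (geo9Y x).M * α₀ ≤ a₀ →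
      ∀ U : (bg9Y (Matrix (Fin N) (Fin N) ℂ) (specialUnitaryUnits (Fin N)) x).Cfg,
        (bg9Y (Matrix (Fin N) (Fin N) ℂ) (specialUnitaryUnits (Fin N)) x).Reg335 c35 α₀ U →
        (bg9Y (Matrix (Fin N) (Fin N) ℂ) (specialUnitaryUnits (Fin N)) x).Reg336 c35 α₀ U →
          HasMajorantHom (g := toB6 (geo9Y x) 1 (H x)) (𝔬12 x).blk (𝔬12 x).blkY ((𝔬12 x).D U ∘ₗ (𝔬12 x).G0 U)
            (fun (a b : (geo9Y x).Site) => B12₀ * (geo9Y x).len a * Real.exp (-(δ12₀ * (geo9Y x).dist a b))))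
    (h26 : B9.Stmt3132Printed (θ.d₆ + 1) c35
      (geo9Y (d := θ.d₆) (ℓ := θ.ℓ₆) (hd := θ.hd') (hL := θ.hL') (b₀ := θ.b₀) (b₁ := θ.b₁) (Mstar := Mstar))
      (bg9Y (Matrix (Fin N) (Fin N) ℂ) (specialUnitaryUnits (Fin N)))
      (fun x => (opsYNuOfRecordV4PE N θ Mstar 𝔯 𝔢 𝔴 𝔈 x).QGQinv) (fun x => (opsYNuOfRecordV4PE N θ Mstar 𝔯 𝔢 𝔴 𝔈 x).QG1Qinv)) :
    ∃ MH δC aH BH : ℝ, 0 < δC ∧ 0 < aH ∧ 0 ≤ BH ∧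
      ∀ δ₃ : ℝ, 0 ≤ δ₃ → δ₃ ≤ δC → δ₃ ≤ δ12₀ →
        ∀ x : MemberY θ.d₆ θ.ℓ₆ θ.hd' θ.hL' θ.b₀ θ.b₁ Mstar, MH ≤ (geo9Y x).M → ∀ α₀ : ℝ, 0 < α₀ → (geo9Y x).M * α₀ ≤ min a₀ aH →
          ∀ U : (bg9Y (Matrix (Fin N) (Fin N) ℂ) (specialUnitaryUnits (Fin N)) x).Cfg,
            (bg9Y (Matrix (Fin N) (Fin N) ℂ) (specialUnitaryUnits (Fin N)) x).Reg335 c35 α₀ U →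
            (bg9Y (Matrix (Fin N) (Fin N) ℂ) (specialUnitaryUnits (Fin N)) x).Reg336 c35 α₀ U →
              LettersHZ (𝔬12 x) 1 (H x) ⟨geo9Y_dist_triangle x, geo9Y_dist_comm x, geo9K_dist_nonneg x.toKIdx, geo9Y_len_pos x⟩
                (weightNorm (BlockNorm.ofBlocks (toB6 (geo9Y x) 1 (H x)) (𝔬12 x).blkZ)
                  (fun y => ((((θ.ℓ₆ + 1 : ℕ) : ℝ) ^ (θ.d₆ + 1)) ^ lvl x.hN x.D x.hk y)⁻¹) (fun y => (plateau_pos x.toKIdx y).le)) BH δ₃ U := by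
  -- [4] (2.61) at rate 1 above ONE threshold (constant floored at 0)
  obtain ⟨ML, c₁, hrow⟩ := rowSum261_geo9Y (d := θ.d₆) (ℓ := θ.ℓ₆) (hd := θ.hd') (hL := θ.hL') (b₀ := θ.b₀) (b₁ := θ.b₁) (Mstar := Mstar) 1 one_pos
  -- row 26's two class letters, rate and constant PRODUCED
  obtain ⟨M₄, δC, a₄, BC, -, hδC, ha₄, hBC, hcc⟩ :=
    c2_c12_pins_of_row26 𝔯 𝔢 𝔴 𝔈 𝔬12 H hblkZ12 hCco12 hC1co12 (fun x y => (plateau_pos x.toKIdx y).le) h26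
  refine ⟨max M₀ (max ML M₄), δC, a₄, max BC (B12₀ * Real.exp ((δC + 1) * ((θ.ℓ₆ : ℝ) + 4)) * max c₁ 0), hδC, ha₄,
    hBC.le.trans (le_max_left _ _), fun δ₃ hδ₃ hδ₃C hδ₃0 x hM α₀ hα ha U hU hU' => ?_⟩
  have hM₀ : M₀ ≤ (geo9Y x).M := (le_max_left _ _).trans hM
  have hML : ML ≤ (geo9Y x).M := ((le_max_left _ _).trans (le_max_right _ _)).trans hM
  have hM₄ : M₄ ≤ (geo9Y x).M := ((le_max_right _ _).trans (le_max_right _ _)).trans hM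
  have ha₀ : (geo9Y x).M * α₀ ≤ a₀ := ha.trans (min_le_left _ _)
  have ha₄' : (geo9Y x).M * α₀ ≤ a₄ := ha.trans (min_le_right _ _)
  have hG : GeoOK (geo9Y x) := ⟨geo9Y_dist_triangle x, geo9Y_dist_comm x, geo9K_dist_nonneg x.toKIdx, geo9Y_len_pos x⟩
  have hrowx : RowSum (toB6 (geo9Y x) 1 (H x)) 1 (max c₁ 0) := fun y => (hrow x hML y).trans (le_max_left _ _)
  have hδQ : 0 ≤ δC + 1 := by linarith
  have hδ₃Q : δ₃ + 1 ≤ δC + 1 := by linarith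
  have hBQ : B12₀ * Real.exp ((δC + 1) * ((θ.ℓ₆ : ℝ) + 4)) * max c₁ 0 ≤
      max BC (B12₀ * Real.exp ((δC + 1) * ((θ.ℓ₆ : ℝ) + 4)) * max c₁ 0) := le_max_right _ _
  obtain ⟨hc2, hc12⟩ := hcc x hM₄ α₀ hα ha₄' U hU hU'
  exact ⟨gQs2_pins x (hβ1 x) hU hrowx (le_max_right _ _) hB12₀ hδQ hδ₃ hδ₃0 hδ₃Q hBQ (hblk12 x) (hblkZ12 x) (hQsco12 x U)
      (he0 x hM₀ α₀ hα ha₀ U hU hU') (fun y => (plateau_pos x.toKIdx y).le),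
    dgQs_pins x (hβ1 x) hU hrowx (le_max_right _ _) hB12₀ hδQ hδ₃ hδ₃0 hδ₃Q hBQ (hblk12 x) (hblkZ12 x) (hQsco12 x U)
      (he1 x hM₀ α₀ hα ha₀ U hU hU') (fun y => (plateau_pos x.toKIdx y).le),
    hc2.mono (kernel_mono hG hBC.le (le_max_left _ _) hδ₃C),
    hc12.mono (kernel_mono hG hBC.le (le_max_left _ _) hδ₃C)⟩

end Summit.QuantumFields.YangMills.BalabanUVNodes.N06LettersH12AtPinsPhys

end
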